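import Summits.QuantumFields.YangMills.Theorems.LuscherReductionTwistedTraceScalingBOTransportEnvelope
import Summits.QuantumFields.YangMills.Theorems.LuscherReductionTwistedTraceScalingBTRatesKappa
import HarnessLib

/-!
# (C2-moments, step (i)) THE TRANSPORT EXPONENT WITH THE FIBRE/GAUGE SIZES KEPT: `|offX + diagX|` is a POLYNOMIAL in the actual squared size
# `S = ‖v̂'‖² + ‖v̂‖² + Σ_x ‖q(g_x) − 1‖²` of the fibre/gauge datum — no sup radii
# (route `FlatTubeReduction`, crux K1 `NearFlatRatioLaw` stmt-QuantumFields-24720, line «ratepack_v2» skeleton v6, stub `stub_hODpot_A`; seat `ym-line-ftr-p1` g18;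
# memo `Cruxes/NearFlatRatioLaw/Lines/ratepack-v6-port-g17.md` §7; R2b1 RECORD rung — no summit statement is proved here)

WHY.  Lane A's pointwise envelope `…BOTransportEnvelope.abs_transportExponent_le` bounds the transport exponent of the fibre transfer by
`coreEta L β δ α T R Γ σ + coreEps1 L β δ T R + coreEps2 L β δ T R σ` with SUP radii `T` (components of `v, v'`, gauge core) and `R` (fibre norms).  At the rate twin's scales
the first-order colour term `β·δ·T² ≍ β^{-1/6}ℓ⁴` is the obstruction to the rate `O(λ_b)` of `stub_hODpot_A` (memo §§5–7).  The cure is to keep the sizes: the hypotheses of the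
envelope are monotone in `T, R`, so it may be applied POINTWISE with `T = R = √S`, `S ≥ ‖linkEmbed v'‖² + ‖linkEmbed v‖² + Σ_x ‖su2Quat (g x) − 1‖²` — every component, every
fibre norm and every gauge deviation is `≤ √S`.  The result is an explicit polynomial in `S` of degree `2` (monomials `S`, `S√S`, `S²`), whose FIRST-ORDER-in-`(α, δ)` part
`β(α + δ)·S` is the potential term of `stub_hODpot_A` after the moment integration (memo §6 (x), (g)), and whose remaining coefficients are second order in the slow displacements.
* §1 `sqrt_le_of_sq_le_kept`, `abs_entry_le_sqrt_kept`, `norm_sub_one_le_sqrt_kept` — the three size facts;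
* §2 ★★ `abs_transportExponent_le_kept` — the envelope with `T = R = √S`;
* §3 ★★ `transportRate_sqrt_le_poly` — the three rates at `T = R = √S` are `≤ K_L·(β(α + δ + α² + δ² + √σ)·S + β(S√S + S²)) + 216βαδΓ`, `K_L = 3·10⁸(|E| + |P×3| + |P|)`, for `β ≥ 1`;
  ★★★ `abs_transportExponent_le_poly` — the pointwise polynomial bound.
HONEST FRAMING: elementary real inequalities for a stub of the CONDITIONAL reduction route R2b1 (rate twin); (C2-moments) steps (ii)–(iv), (C1)-rate, (B-ST), the crux remain
OPEN; femto rung R2b1 (RECORD label); not infinite volume, not a mass gap, not Clay.  No defs, no named facts, no `sorry`.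
-/

set_option autoImplicit false

noncomputable section

open MeasureTheory Filter Topology Real
open scoped BigOperators
open Literature.MathematicalPhysics.QuantumFieldTheory
open Literature.MathematicalPhysics.QuantumLattice

namespace Summit.QuantumFields.YangMills.Theorems.FemtoTransferGap.TwoLattice.ConstTube

open Summit.QuantumFields.YangMills.Theorems.FemtoTransferGap
open Summit.QuantumFields.YangMills.Theorems.FemtoTransferGap.TwoLattice
open Summit.QuantumFields.YangMills.Theorems.FemtoTransferGap.TwoLattice.Avg
open Summit.QuantumFields.YangMills.Theorems.FemtoTransferGap.TwoLattice.Stiff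
open Summit.QuantumFields.YangMills.Theorems.FemtoTransferGap.TwoLattice.Cov

variable {L : ℕ} [NeZero L]

/-! ## §1 Sizes below `√S` -/

/-- `a² ≤ S ⇒ a ≤ √S`. [folklore] -/
theorem sqrt_le_of_sq_le_kept {a S : ℝ} (h : a ^ 2 ≤ S) : a ≤ Real.sqrt S := by
  calc a ≤ |a| := le_abs_self a
    _ = Real.sqrt (a ^ 2) := (Real.sqrt_sq_eq_abs a).symm
    _ ≤ Real.sqrt S := Real.sqrt_le_sqrt h

/-- Entries are below the root of any majorant of the squared norm: `‖linkEmbed v‖² ≤ S ⇒ |v_{e,c}| ≤ √S`. [folklore] -/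
theorem abs_entry_le_sqrt_kept {v : Edge 3 L → Fin 3 → ℝ} {S : ℝ} (h : ‖linkEmbed L v‖ ^ 2 ≤ S) (e : Edge 3 L) (c : Fin 3) : |v e c| ≤ Real.sqrt S := by
  have h1 : |v e c| ≤ ‖linkEmbed L v‖ := by
    have h2 := PiLp.norm_apply_le (linkEmbed L v) (e, c)
    rwa [Real.norm_eq_abs, linkEmbed_apply] at h2
  exact h1.trans (sqrt_le_of_sq_le_kept h)

/-- Gauge deviations are below the root of any majorant of their squared sum. [folklore] -/
theorem norm_sub_one_le_sqrt_kept {g : Site 3 L → SU2} {S : ℝ} (h : ∑ x, ‖su2Quat (g x) - 1‖ ^ 2 ≤ S) (x : Site 3 L) : ‖su2Quat (g x) - 1‖ ≤ Real.sqrt S := by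
  refine sqrt_le_of_sq_le_kept (le_trans ?_ h)
  exact Finset.single_le_sum (f := fun y => ‖su2Quat (g y) - 1‖ ^ 2) (fun y _ => sq_nonneg _) (Finset.mem_univ x)

/-! ## §2 ★★ The envelope with the sizes kept -/

/-- ★★ **THE TRANSPORT EXPONENT WITH THE SIZES KEPT.**  Lane A's `abs_transportExponent_le` applied pointwise with `T = R = √S` for ANY
`S ≥ ‖linkEmbed v'‖² + ‖linkEmbed v‖² + Σ_x ‖su2Quat (g x) − 1‖²` with `S ≤ 1/900`: for the output slow point `u'` (`‖q(u'_k) − 1‖ ≤ δ ≤ 1/2`), the input slow point `u`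
(`‖q(u'_k) − q(u_k)‖ ≤ α ≤ 1`), one-site actions `≤ σ/L³` (`σ < 2`), cap-balanced fibre data `v', v` and a gauge field with `‖Σ_x g⃗_x‖ ≤ Γ`:
`|offX β u' u v' v g + diagX β u' v' v g| ≤ coreEta L β δ α √S √S Γ σ + coreEps1 L β δ √S √S + coreEps2 L β δ √S √S σ`. [cite: Luscher1983, §3] -/
theorem abs_transportExponent_le_kept {β : ℝ} (hβ : 0 ≤ β) (u' u : GaugeConfig 3 1 SU2) {v' v : Edge 3 L → Fin 3 → ℝ} (hv' : v' ∈ capBalancedSet L)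
    (hv : v ∈ capBalancedSet L) {g : Site 3 L → SU2} {δ α Γ σ S : ℝ}
    (hδ : ∀ k : Fin 3, ‖su2Quat (u' (0, k)) - 1‖ ≤ δ) (hδ1 : δ ≤ 1 / 2) (hα : ∀ k : Fin 3, ‖su2Quat (u' (0, k)) - su2Quat (u (0, k))‖ ≤ α) (hα1 : α ≤ 1)
    (hσ : σ < 2) (hS' : (L : ℝ) ^ 3 * wilsonAction su2Rep u' ≤ σ) (hS : (L : ℝ) ^ 3 * wilsonAction su2Rep u ≤ σ) (hΓ : ‖∑ x, vecPart (g x)‖ ≤ Γ)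
    (hSge : ‖linkEmbed L v'‖ ^ 2 + ‖linkEmbed L v‖ ^ 2 + ∑ x, ‖su2Quat (g x) - 1‖ ^ 2 ≤ S) (hS900 : S ≤ 1 / 900) :
    |offX L β u' u v' v g + diagX L β u' v' v g| ≤
      coreEta L β δ α (Real.sqrt S) (Real.sqrt S) Γ σ + coreEps1 L β δ (Real.sqrt S) (Real.sqrt S) + coreEps2 L β δ (Real.sqrt S) (Real.sqrt S) σ := by
  have hn1 : 0 ≤ ‖linkEmbed L v'‖ ^ 2 := sq_nonneg _
  have hn2 : 0 ≤ ‖linkEmbed L v‖ ^ 2 := sq_nonneg _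
  have hn3 : 0 ≤ ∑ x, ‖su2Quat (g x) - 1‖ ^ 2 := Finset.sum_nonneg fun _ _ => sq_nonneg _
  have hv'S : ‖linkEmbed L v'‖ ^ 2 ≤ S := by linarith
  have hvS : ‖linkEmbed L v‖ ^ 2 ≤ S := by linarith
  have hgS : ∑ x, ‖su2Quat (g x) - 1‖ ^ 2 ≤ S := by linarith
  have hT : Real.sqrt S ≤ 1 / 30 := by
    rw [show (1 : ℝ) / 30 = Real.sqrt (1 / 900) by rw [show (1 : ℝ) / 900 = (1 / 30) ^ 2 by norm_num, Real.sqrt_sq (by norm_num)]]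
    exact Real.sqrt_le_sqrt hS900
  exact abs_transportExponent_le hβ u' u hv' hv hδ hδ1 hα hα1 hT hσ hS' hS (abs_entry_le_sqrt_kept hv'S) (sqrt_le_of_sq_le_kept hv'S)
    (abs_entry_le_sqrt_kept hvS) (sqrt_le_of_sq_le_kept hvS) (norm_sub_one_le_sqrt_kept hgS) hΓ

/-! ## §3 ★★★ The polynomial form -/

/-- ★★ **The three rates at `T = R = √S` are a polynomial in `S`**: for `β ≥ 1`, `0 ≤ δ, α`, `0 ≤ σ < 2`, `0 ≤ S`,
`coreEta L β δ α √S √S Γ σ + coreEps1 L β δ √S √S + coreEps2 L β δ √S √S σ ≤ K_L·(β·(α + δ + α² + δ² + √σ)·S + β·(S·√S + S²)) + 216·β·α·δ·Γ`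
with `K_L = 3·10⁸·(|E| + |P × Fin 3| + |P|)`. [folklore] -/
theorem transportRate_sqrt_le_poly {β δ α Γ σ S : ℝ} (hβ1 : 1 ≤ β) (hδ0 : 0 ≤ δ) (hα0 : 0 ≤ α) (hσ0 : 0 ≤ σ) (hσ : σ < 2) (hS0 : 0 ≤ S) :
    coreEta L β δ α (Real.sqrt S) (Real.sqrt S) Γ σ + coreEps1 L β δ (Real.sqrt S) (Real.sqrt S) + coreEps2 L β δ (Real.sqrt S) (Real.sqrt S) σ ≤
      300000000 * ((Fintype.card (Edge 3 L) : ℝ) + (Fintype.card (Plaquette 3 L × Fin 3) : ℝ) + (Fintype.card (Plaquette 3 L) : ℝ)) *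
          (β * (α + δ + α ^ 2 + δ ^ 2 + Real.sqrt σ) * S + β * (S * Real.sqrt S + S ^ 2)) +
        216 * β * α * δ * Γ := by
  have hE0 : (0 : ℝ) ≤ (Fintype.card (Edge 3 L) : ℝ) := Nat.cast_nonneg _
  have hN0 : (0 : ℝ) ≤ (Fintype.card (Plaquette 3 L × Fin 3) : ℝ) := Nat.cast_nonneg _
  have hP0 : (0 : ℝ) ≤ (Fintype.card (Plaquette 3 L) : ℝ) := Nat.cast_nonneg _
  have hβ0 : 0 ≤ β := by linarith
  have hr0 : 0 ≤ Real.sqrt S := Real.sqrt_nonneg _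
  have hrσ0 : 0 ≤ Real.sqrt σ := Real.sqrt_nonneg _
  have hSS : Real.sqrt S * Real.sqrt S = S := Real.mul_self_sqrt hS0
  have hS2 : Real.sqrt S ^ 2 = S := by rw [sq, hSS]
  have hS3 : Real.sqrt S ^ 3 = S * Real.sqrt S := by rw [pow_succ, hS2]
  have hS4 : Real.sqrt S ^ 4 = S ^ 2 := by rw [show (4 : ℕ) = 2 * 2 by norm_num, pow_mul, hS2]
  have hσσ : Real.sqrt σ * Real.sqrt σ = σ := Real.mul_self_sqrt hσ0
  -- `σ ≤ 2√σ` and `σ² ≤ 4√σ` (`0 ≤ σ < 2`)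
  have hσ1 : σ ≤ 2 * Real.sqrt σ := by
    have h1 : Real.sqrt σ ≤ Real.sqrt 2 := Real.sqrt_le_sqrt hσ.le
    have h2 : Real.sqrt 2 ≤ 2 := by
      rw [show (2 : ℝ) = Real.sqrt 4 by rw [show (4 : ℝ) = 2 ^ 2 by norm_num, Real.sqrt_sq (by norm_num)]]
      exact Real.sqrt_le_sqrt (by norm_num)
    nlinarith [hσσ, h1, h2, hrσ0]
  have hσ2 : σ ^ 2 ≤ 4 * Real.sqrt σ := by nlinarith [hσ1, hσ.le, hσ0]
  -- unfold the three rates at `T = R = √S` and normalise the powers of `√S`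
  have h24 : (2 * δ) * Real.sqrt S * (12 * Real.sqrt S) = 24 * δ * S := by
    rw [show (2 * δ) * Real.sqrt S * (12 * Real.sqrt S) = 24 * δ * (Real.sqrt S * Real.sqrt S) by ring, hSS]
  have h12 : δ ^ 2 * Real.sqrt S * (12 * Real.sqrt S) = 12 * δ ^ 2 * S := by
    rw [show δ ^ 2 * Real.sqrt S * (12 * Real.sqrt S) = 12 * δ ^ 2 * (Real.sqrt S * Real.sqrt S) by ring, hSS]
  unfold coreEta coreEps1 coreEps2 stepActionErr
  rw [h24, h12]
  simp only [mul_pow, Real.sq_sqrt hN0, Real.sq_sqrt hS0, hS3, hS4, Real.sqrt_zero, mul_zero, zero_add]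
  -- generalize the three lattice counts
  generalize hE : (Fintype.card (Edge 3 L) : ℝ) = E at hE0 ⊢
  generalize hN : (Fintype.card (Plaquette 3 L × Fin 3) : ℝ) = N at hN0 ⊢
  generalize hP : (Fintype.card (Plaquette 3 L) : ℝ) = P at hP0 ⊢
  -- the monomials
  have m1 : 0 ≤ β * α * S := by positivity
  have m2 : 0 ≤ β * δ * S := by positivity
  have m3 : 0 ≤ β * α ^ 2 * S := by positivity
  have m4 : 0 ≤ β * δ ^ 2 * S := by positivity
  have m5 : 0 ≤ β * Real.sqrt σ * S := by positivity
  have m6 : 0 ≤ β * (S * Real.sqrt S) := by positivity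
  have m7 : 0 ≤ β * S ^ 2 := by positivity
  have e1 := mul_nonneg hE0 m1; have e2 := mul_nonneg hE0 m2; have e3 := mul_nonneg hE0 m3; have e4 := mul_nonneg hE0 m4
  have e5 := mul_nonneg hE0 m5; have e6 := mul_nonneg hE0 m6; have e7 := mul_nonneg hE0 m7
  have n1 := mul_nonneg hN0 m1; have n2 := mul_nonneg hN0 m2; have n3 := mul_nonneg hN0 m3; have n4 := mul_nonneg hN0 m4
  have n5 := mul_nonneg hN0 m5; have n6 := mul_nonneg hN0 m6; have n7 := mul_nonneg hN0 m7
  have p1 := mul_nonneg hP0 m1; have p2 := mul_nonneg hP0 m2; have p3 := mul_nonneg hP0 m3; have p4 := mul_nonneg hP0 m4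
  have p5 := mul_nonneg hP0 m5; have p6 := mul_nonneg hP0 m6; have p7 := mul_nonneg hP0 m7
  -- the five comparisons
  have f1 : β * σ * N * S ≤ 2 * (β * Real.sqrt σ * N * S) := by
    have h := mul_le_mul_of_nonneg_left hσ1 (by positivity : 0 ≤ β * N * S)
    linarith only [h]
  have f2 : β * σ ^ 2 * N * S ≤ 4 * (β * Real.sqrt σ * N * S) := by
    have h := mul_le_mul_of_nonneg_left hσ2 (by positivity : 0 ≤ β * N * S)
    linarith only [h]
  have f3 : P * (S * Real.sqrt S) ≤ β * (P * (S * Real.sqrt S)) := le_mul_of_one_le_left (by positivity) hβ1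
  have f4 : P * S ^ 2 ≤ β * (P * S ^ 2) := le_mul_of_one_le_left (by positivity) hβ1
  have f5 : N * δ ^ 2 * S ≤ β * (N * δ ^ 2 * S) := le_mul_of_one_le_left (by positivity) hβ1
  linarith only [e1, e2, e3, e4, e5, e6, e7, n1, n2, n3, n4, n5, n6, n7, p1, p2, p3, p4, p5, p6, p7, f1, f2, f3, f4, f5]

/-- ★★★ **POINTWISE POLYNOMIAL BOUND ON THE TRANSPORT EXPONENT.**  Under the hypotheses of `abs_transportExponent_le_kept` and `β ≥ 1`:
`|offX β u' u v' v g + diagX β u' v' v g| ≤ K_L·(β(α + δ + α² + δ² + √σ)·S + β(S√S + S²)) + 216βαδΓ`, `K_L = 3·10⁸(|E| + |P × Fin 3| + |P|)`,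
for any `S ∈ [‖linkEmbed v'‖² + ‖linkEmbed v‖² + Σ_x ‖q(g_x) − 1‖², 1/900]`. [cite: Luscher1983, §3] -/
theorem abs_transportExponent_le_poly {β : ℝ} (hβ1 : 1 ≤ β) (u' u : GaugeConfig 3 1 SU2) {v' v : Edge 3 L → Fin 3 → ℝ} (hv' : v' ∈ capBalancedSet L)
    (hv : v ∈ capBalancedSet L) {g : Site 3 L → SU2} {δ α Γ σ S : ℝ}
    (hδ : ∀ k : Fin 3, ‖su2Quat (u' (0, k)) - 1‖ ≤ δ) (hδ1 : δ ≤ 1 / 2) (hα : ∀ k : Fin 3, ‖su2Quat (u' (0, k)) - su2Quat (u (0, k))‖ ≤ α) (hα1 : α ≤ 1)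
    (hσ : σ < 2) (hS' : (L : ℝ) ^ 3 * wilsonAction su2Rep u' ≤ σ) (hS : (L : ℝ) ^ 3 * wilsonAction su2Rep u ≤ σ) (hΓ : ‖∑ x, vecPart (g x)‖ ≤ Γ)
    (hSge : ‖linkEmbed L v'‖ ^ 2 + ‖linkEmbed L v‖ ^ 2 + ∑ x, ‖su2Quat (g x) - 1‖ ^ 2 ≤ S) (hS900 : S ≤ 1 / 900) :
    |offX L β u' u v' v g + diagX L β u' v' v g| ≤
      300000000 * ((Fintype.card (Edge 3 L) : ℝ) + (Fintype.card (Plaquette 3 L × Fin 3) : ℝ) + (Fintype.card (Plaquette 3 L) : ℝ)) *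
          (β * (α + δ + α ^ 2 + δ ^ 2 + Real.sqrt σ) * S + β * (S * Real.sqrt S + S ^ 2)) +
        216 * β * α * δ * Γ := by
  have hβ : 0 ≤ β := by linarith
  have hδ0 : 0 ≤ δ := (norm_nonneg _).trans (hδ 0)
  have hα0 : 0 ≤ α := (norm_nonneg _).trans (hα 0)
  have hσ0 : 0 ≤ σ := le_trans (mul_nonneg (by positivity) (wilsonAction_su2_nonneg u)) hS
  have hS0 : 0 ≤ S := by
    have hn3 : 0 ≤ ∑ x, ‖su2Quat (g x) - 1‖ ^ 2 := Finset.sum_nonneg fun _ _ => sq_nonneg _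
    nlinarith [sq_nonneg ‖linkEmbed L v'‖, sq_nonneg ‖linkEmbed L v‖]
  exact (abs_transportExponent_le_kept hβ u' u hv' hv hδ hδ1 hα hα1 hσ hS' hS hΓ hSge hS900).trans (transportRate_sqrt_le_poly hβ1 hδ0 hα0 hσ0 hσ hS0)

end Summit.QuantumFields.YangMills.Theorems.FemtoTransferGap.TwoLattice.ConstTube

end
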